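import Literature.Barriers.AtomisticToContinuum.EnergyAsymptoticsWithoutCondensationComparison

/-!
# Estimates for the two-order law of the Lieb–Liniger energy

Third of the sibling files proving the named fact
`Literature.Barriers.AtomisticToContinuum.EnergyAsymptoticsWithoutCondensation`
(= `BoseGas.LiebLiniger.LiebLiniger_bogoliubovTwoOrders`, LSSY (B.19):
`e(γ) = γ - (4/3π)γ^{3/2} + o(γ^{3/2})` for every continuous solution of (B.14)–(B.15)).

Notation (all statements are explicit; no new definitions): `κ > 0` the scaled coupling, `g` a
continuous solution of the Love equation on `[-1, 1]` (hypotheses `hg`, `hgeq`), `A = 1 - k²`,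
`B = imRoot k κ`, `D = dRoot k κ = A + κ²`, `ω = B - √A ≥ 0`, and the residual
`r₀(k) = (2/(3κ))[B D - A√A - 2k²κ²/B - κ³]`, which is `(I - K_κ)v - (2k² - 1)` for the dual test
function `v = -(2/(3κ)) A√A` (file 1 closed forms).

* Pointwise bounds (`imRoot_sub_sqrt_le`, `sqrt_le_two_imRoot`, `abs_residual_le`,
  `abs_bracket_mul_sqrt_le`): `ω ≤ 4κ²/(A+κ)^{3/2}`, `√(A+κ) ≤ 2B`, `|r₀| ≤ 8κ/√(A+κ)`,
  `|bracket · √A| ≤ 8κ²` on `[-1,1]`, `κ ≤ 1`.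
* One-dimensional integrals (`integral_inv_one_sub_sq_add_le` & co.):
  `∫ dk/(A+κ) ≤ 2 log((2+κ)/κ)`, `∫ dk/(A+κ)^{3/2} ≤ 4/√κ`, `∫ dk/√(A+κ) ≤ 4√3`,
  `∫ A√A = 3π/8`, `∫ (1 - 2k²) = 2/3`.
* The two duality identities (`kappa_mul_integral_eq`, `integral_chebyshev_mul_eq`):
  `κ∫g = 1/4 + ∫ωg` (so `m := 4κ∫g = 1 + 4∫ωg ≥ 1`) and `∫(2k²-1)g = -1/(8κ) - ∫r₀g`.
* The two small terms (`integral_omega_mul_le`, `abs_integral_residual_mul_sub_le`): with the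
  supersolution of width `a² = 1 + η`, `κ ≤ η ≤ 1`, `θ = κ(1+η)/(2η√η) ≤ 1/2`:
  `∫ωg ≤ (8/π)[κ log((2+κ)/κ) + 2√η√κ]` and
  `|∫ r₀ (g - √A/(2πκ))| ≤ (8/π) η log((2+κ)/κ) + (96/π) θ`.

The limit `∫ r₀ √A/(2πκ) → 1/(3π)` (dominated convergence) and the assembly are in
`EnergyAsymptoticsWithoutCondensationProofs`.

## References

* [LSSY2005] E. H. Lieb, R. Seiringer, J. P. Solovej, J. Yngvason, *The Mathematics of the Bose
  Gas and its Condensation*, Birkhäuser 2005, App. B (B.14)–(B.19).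
-/

noncomputable section

open MeasureTheory Set Filter Real intervalIntegral Metric
open scoped Topology

namespace Literature.Barriers.AtomisticToContinuum.BoseGas.LiebLiniger

/-! ### Pointwise bounds on `ω = B - √(1-k²)` and on the residual `r₀` -/

section Pointwise

variable {κ k : ℝ}

/-- `0 ≤ B - √(1-k²)`. [folklore] -/
lemma imRoot_sub_sqrt_nonneg (hκ : 0 < κ) :
    0 ≤ imRoot k κ - √(1 - k ^ 2) := by
  have hB := imRoot_pos k hκ
  have h1 : 1 - k ^ 2 ≤ imRoot k κ ^ 2 := by
    have := dRoot_le_imRoot_sq k hκ; unfold dRoot at this; nlinarith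
  have : √(1 - k ^ 2) ≤ imRoot k κ := by
    calc √(1 - k ^ 2) ≤ √(imRoot k κ ^ 2) := Real.sqrt_le_sqrt h1
      _ = imRoot k κ := Real.sqrt_sq hB.le
  linarith

/-- Bulk bound `B - √(1-k²) ≤ κ²/((1-k²)√(1-k²))` for `|k| < 1`. [folklore] -/
lemma imRoot_sub_sqrt_le_bulk (hκ : 0 < κ) (hA : 0 < 1 - k ^ 2) :
    imRoot k κ - √(1 - k ^ 2) ≤ κ ^ 2 / ((1 - k ^ 2) * √(1 - k ^ 2)) := by
  set A := 1 - k ^ 2 with hA'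
  have hk2 : k ^ 2 < 1 := by linarith
  have hA1 : A ≤ 1 := by rw [hA']; nlinarith
  have hB := imRoot_pos k hκ
  have hD : dRoot k κ = A + κ ^ 2 := by simp [dRoot, hA']
  have hD0 : 0 < dRoot k κ := by rw [hD]; positivity
  have hsA : 0 < √A := Real.sqrt_pos.2 hA
  have hsD : 0 < √(dRoot k κ) := Real.sqrt_pos.2 hD0
  have hAD : A ≤ dRoot k κ := by rw [hD]; nlinarith
  have hsAD : √A ≤ √(dRoot k κ) := Real.sqrt_le_sqrt hAD
  -- `B - √D ≤ k²κ²/(2 D √D) ≤ κ²/(2 A √A)`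
  have h1 : imRoot k κ - √(dRoot k κ) ≤ κ ^ 2 / (2 * (A * √A)) := by
    have hBD : √(dRoot k κ) ≤ imRoot k κ := by
      calc √(dRoot k κ) ≤ √(imRoot k κ ^ 2) := Real.sqrt_le_sqrt (dRoot_le_imRoot_sq k hκ)
        _ = imRoot k κ := Real.sqrt_sq hB.le
    have hsq := imRoot_sq_le_bulk k hκ hD0
    have hDsq : √(dRoot k κ) ^ 2 = dRoot k κ := Real.sq_sqrt hD0.le
    -- (B - √D)(B + √D) = B² - D ≤ k²κ²/D ≤ κ²/A
    have h2 : (imRoot k κ - √(dRoot k κ)) * (2 * √(dRoot k κ)) ≤ κ ^ 2 / A := by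
      have h3 : k ^ 2 * κ ^ 2 / dRoot k κ ≤ κ ^ 2 / A := by
        rw [div_le_div_iff₀ hD0 hA]
        nlinarith [sq_nonneg κ, mul_nonneg (sq_nonneg κ) hA.le]
      nlinarith
    have h4 : κ ^ 2 / A / (2 * √(dRoot k κ)) ≤ κ ^ 2 / (2 * (A * √A)) := by
      rw [div_div]
      apply div_le_div_of_nonneg_left (by positivity) (by positivity)
      nlinarith
    calc imRoot k κ - √(dRoot k κ) ≤ κ ^ 2 / A / (2 * √(dRoot k κ)) := by
          rw [le_div_iff₀ (by positivity)]; exact h2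
      _ ≤ κ ^ 2 / (2 * (A * √A)) := h4
  -- `√D - √A ≤ κ²/(2√A) ≤ κ²/(2 A √A)`
  have h5 : √(dRoot k κ) - √A ≤ κ ^ 2 / (2 * (A * √A)) := by
    have h6 : (√(dRoot k κ) - √A) * (√(dRoot k κ) + √A) = κ ^ 2 := by
      have := Real.sq_sqrt hD0.le
      have := Real.sq_sqrt hA.le
      nlinarith
    have h7 : √(dRoot k κ) - √A ≤ κ ^ 2 / (2 * √A) := by
      rw [le_div_iff₀ (by positivity)]; nlinarith
    have h8 : κ ^ 2 / (2 * √A) ≤ κ ^ 2 / (2 * (A * √A)) := by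
      apply div_le_div_of_nonneg_left (by positivity) (by positivity)
      nlinarith
    linarith
  have : κ ^ 2 / (A * √A) = κ ^ 2 / (2 * (A * √A)) + κ ^ 2 / (2 * (A * √A)) := by ring
  rw [this]
  linarith

/-- Edge bound `B - √(1-k²) ≤ 2κ/√(1-k²+κ)` for `|k| ≤ 1`, `κ ≤ 1`. [folklore] -/
lemma imRoot_sub_sqrt_le_edge (hκ : 0 < κ) (hκ1 : κ ≤ 1) (hk : k ∈ Icc (-1 : ℝ) 1) :
    imRoot k κ - √(1 - k ^ 2) ≤ 2 * κ / √(1 - k ^ 2 + κ) := by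
  set A := 1 - k ^ 2 with hA'
  have hk1 : |k| ≤ 1 := abs_le.2 ⟨by linarith [hk.1], hk.2⟩
  have hA : 0 ≤ A := by rw [hA']; nlinarith [hk.1, hk.2]
  have hB := imRoot_pos k hκ
  have hD : dRoot k κ = A + κ ^ 2 := by simp [dRoot, hA']
  have hsq : imRoot k κ ^ 2 ≤ A + κ + κ ^ 2 := by
    have := imRoot_sq_le_edge k hκ (by rw [hD]; positivity)
    rw [hD] at this
    nlinarith [mul_le_mul_of_nonneg_right hk1 hκ.le]
  have hBle : imRoot k κ ≤ √(A + κ + κ ^ 2) := Real.le_sqrt_of_sq_le hsq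
  have hs1 : 0 < √(A + κ) := Real.sqrt_pos.2 (by positivity)
  have hs2 : √(A + κ) ≤ √(A + κ + κ ^ 2) := Real.sqrt_le_sqrt (by nlinarith)
  have h1 : (√(A + κ + κ ^ 2) - √A) * (√(A + κ + κ ^ 2) + √A) = κ + κ ^ 2 := by
    have := Real.sq_sqrt (by positivity : 0 ≤ A + κ + κ ^ 2)
    have := Real.sq_sqrt hA
    nlinarith
  have h2 : √(A + κ + κ ^ 2) - √A ≤ (κ + κ ^ 2) / √(A + κ) := by
    rw [le_div_iff₀ hs1]
    have := Real.sqrt_nonneg A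
    nlinarith
  have h3 : (κ + κ ^ 2) / √(A + κ) ≤ 2 * κ / √(A + κ) := by
    apply div_le_div_of_nonneg_right _ hs1.le
    nlinarith
  linarith

/-- Uniform bound `B - √(1-k²) ≤ 4κ²/((1-k²+κ)√(1-k²+κ))` for `|k| ≤ 1`, `κ ≤ 1`. [folklore] -/
lemma imRoot_sub_sqrt_le (hκ : 0 < κ) (hκ1 : κ ≤ 1) (hk : k ∈ Icc (-1 : ℝ) 1) :
    imRoot k κ - √(1 - k ^ 2) ≤ 4 * κ ^ 2 / ((1 - k ^ 2 + κ) * √(1 - k ^ 2 + κ)) := by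
  set A := 1 - k ^ 2 with hA'
  have hA : 0 ≤ A := by rw [hA']; nlinarith [hk.1, hk.2]
  have hs : 0 < √(A + κ) := Real.sqrt_pos.2 (by positivity)
  rcases le_or_gt κ A with hκA | hκA
  · -- bulk
    have hA0 : 0 < A := lt_of_lt_of_le hκ hκA
    have h1 := imRoot_sub_sqrt_le_bulk hκ hA0
    have hsA : 0 < √A := Real.sqrt_pos.2 hA0
    have h2 : (A + κ) * √(A + κ) ≤ 4 * (A * √A) := by
      have h3 : A + κ ≤ 2 * A := by linarith
      have h4 : √(A + κ) ≤ √(4 * A) := Real.sqrt_le_sqrt (by linarith)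
      rw [show (4 : ℝ) * A = 2 ^ 2 * A by norm_num, Real.sqrt_mul' _ hA, Real.sqrt_sq (by norm_num)] at h4
      calc (A + κ) * √(A + κ) ≤ (2 * A) * (2 * √A) := by gcongr
        _ = 4 * (A * √A) := by ring
    calc imRoot k κ - √A ≤ κ ^ 2 / (A * √A) := h1
      _ ≤ 4 * κ ^ 2 / ((A + κ) * √(A + κ)) := by
          rw [div_le_div_iff₀ (by positivity) (by positivity)]
          nlinarith [sq_nonneg κ]
  · -- edge
    have h1 := imRoot_sub_sqrt_le_edge hκ hκ1 hk
    calc imRoot k κ - √A ≤ 2 * κ / √(A + κ) := h1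
      _ = 2 * κ * (A + κ) / ((A + κ) * √(A + κ)) := by
          field_simp
      _ ≤ 4 * κ ^ 2 / ((A + κ) * √(A + κ)) := by
          apply div_le_div_of_nonneg_right _ (by positivity)
          nlinarith

/-- `√(1-k²+κ) ≤ 2B` for `|k| ≤ 1`, `κ ≤ 1`. [folklore] -/
lemma sqrt_le_two_imRoot (hκ : 0 < κ) (hκ1 : κ ≤ 1) (hk : k ∈ Icc (-1 : ℝ) 1) :
    √(1 - k ^ 2 + κ) ≤ 2 * imRoot k κ := by
  set A := 1 - k ^ 2 with hA'
  have hA : 0 ≤ A := by rw [hA']; nlinarith [hk.1, hk.2]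
  have hB := imRoot_pos k hκ
  have hD : dRoot k κ = A + κ ^ 2 := by simp [dRoot, hA']
  have hBD : A + κ ^ 2 ≤ imRoot k κ ^ 2 := by rw [← hD]; exact dRoot_le_imRoot_sq k hκ
  have hBk : |k| * κ ≤ imRoot k κ ^ 2 := abs_mul_le_imRoot_sq k hκ (by rw [hD]; positivity)
  rw [show 2 * imRoot k κ = √((2 * imRoot k κ) ^ 2) by rw [Real.sqrt_sq (by positivity)]]
  apply Real.sqrt_le_sqrt
  rcases le_or_gt (1 / 2) |k| with hk2 | hk2
  · nlinarith
  · have : k ^ 2 < 1 / 4 := by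
      have : |k| ^ 2 = k ^ 2 := sq_abs k
      nlinarith [abs_nonneg k]
    nlinarith

/-- **Residual bound.** With `A = 1-k²`, `D = A + κ²`, `B = B(k,κ)`,
`|(2/(3κ))[B D - A√A - 2k²κ²/B - κ³]| ≤ 8κ/√(A+κ)` for `|k| ≤ 1`, `0 < κ ≤ 1`. [folklore] -/
lemma abs_residual_le (hκ : 0 < κ) (hκ1 : κ ≤ 1) (hk : k ∈ Icc (-1 : ℝ) 1) :
    |2 / (3 * κ) * (imRoot k κ * dRoot k κ - (1 - k ^ 2) * √(1 - k ^ 2)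
        - 2 * k ^ 2 * κ ^ 2 / imRoot k κ - κ ^ 3)| ≤ 8 * κ / √(1 - k ^ 2 + κ) := by
  set A := 1 - k ^ 2 with hA'
  have hk2 : k ^ 2 ≤ 1 := by nlinarith [hk.1, hk.2]
  have hA : 0 ≤ A := by rw [hA']; linarith
  have hA1 : A ≤ 1 := by rw [hA']; nlinarith
  have hB := imRoot_pos k hκ
  have hD : dRoot k κ = A + κ ^ 2 := by simp [dRoot, hA']
  have hs : 0 < √(A + κ) := Real.sqrt_pos.2 (by positivity)
  have hs1 : √(A + κ) ≤ √2 := Real.sqrt_le_sqrt (by linarith)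
  have hsA1 : √A ≤ 1 := by rw [show (1:ℝ) = √1 by simp]; exact Real.sqrt_le_sqrt hA1
  set ω := imRoot k κ - √A with hω
  have hω0 : 0 ≤ ω := imRoot_sub_sqrt_nonneg hκ
  have hωle := imRoot_sub_sqrt_le hκ hκ1 hk
  have h2B := sqrt_le_two_imRoot hκ hκ1 hk
  -- rewrite the bracket as `κ²√A + ωD - 2k²κ²/B - κ³`
  have hbr : imRoot k κ * dRoot k κ - A * √A - 2 * k ^ 2 * κ ^ 2 / imRoot k κ - κ ^ 3
      = (κ ^ 2 * √A + ω * (A + κ ^ 2)) - (2 * k ^ 2 * κ ^ 2 / imRoot k κ + κ ^ 3) := by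
    rw [hD, hω]; ring
  rw [hbr]
  -- bounds on the four terms
  have t1 : κ ^ 2 * √A ≤ κ ^ 2 := by nlinarith [sq_nonneg κ]
  have t2 : ω * (A + κ ^ 2) ≤ 4 * κ ^ 2 / √(A + κ) := by
    have hAκ : A + κ ^ 2 ≤ A + κ := by nlinarith
    calc ω * (A + κ ^ 2) ≤ 4 * κ ^ 2 / ((A + κ) * √(A + κ)) * (A + κ) := by gcongr
      _ = 4 * κ ^ 2 / √(A + κ) := by field_simp
  have t3 : 2 * k ^ 2 * κ ^ 2 / imRoot k κ ≤ 4 * κ ^ 2 / √(A + κ) := by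
    rw [div_le_div_iff₀ hB hs]
    have : k ^ 2 * √(A + κ) ≤ 2 * imRoot k κ := by nlinarith [hs.le]
    nlinarith [sq_nonneg κ]
  have t4 : κ ^ 3 ≤ κ ^ 2 := by nlinarith [sq_nonneg κ]
  have t5 : κ ^ 2 ≤ κ ^ 2 * √2 / √(A + κ) := by
    rw [le_div_iff₀ hs]; nlinarith [sq_nonneg κ]
  have hpos1 : 0 ≤ κ ^ 2 * √A + ω * (A + κ ^ 2) := by positivity
  have hpos2 : 0 ≤ 2 * k ^ 2 * κ ^ 2 / imRoot k κ + κ ^ 3 := by positivity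
  have hκ2 : 0 ≤ κ ^ 2 := sq_nonneg κ
  have hb0 : 0 ≤ 4 * κ ^ 2 / √(A + κ) := by positivity
  have habs : |(κ ^ 2 * √A + ω * (A + κ ^ 2)) - (2 * k ^ 2 * κ ^ 2 / imRoot k κ + κ ^ 3)|
      ≤ 2 * (κ ^ 2 * √2 / √(A + κ)) + 8 * κ ^ 2 / √(A + κ) := by
    have e8 : 8 * κ ^ 2 / √(A + κ) = 2 * (4 * κ ^ 2 / √(A + κ)) := by ring
    rw [e8, abs_le]
    constructor
    · linarith [hpos1, hpos2, t1, t2, t3, t4, t5]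
    · linarith [hpos1, hpos2, t1, t2, t3, t4, t5]
  have h23 : (0 : ℝ) < 2 / (3 * κ) := by positivity
  rw [abs_mul, abs_of_pos h23]
  calc 2 / (3 * κ) * |(κ ^ 2 * √A + ω * (A + κ ^ 2)) - (2 * k ^ 2 * κ ^ 2 / imRoot k κ + κ ^ 3)|
      ≤ 2 / (3 * κ) * (2 * (κ ^ 2 * √2 / √(A + κ)) + 8 * κ ^ 2 / √(A + κ)) := by gcongr
    _ = (4 * √2 + 16) / 3 * κ / √(A + κ) := by field_simp; ring
    _ ≤ 8 * κ / √(A + κ) := by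
        apply div_le_div_of_nonneg_right _ hs.le
        have : √2 ≤ 2 := by
          rw [show (2:ℝ) = √(2 ^ 2) by rw [Real.sqrt_sq (by norm_num)]]
          exact Real.sqrt_le_sqrt (by norm_num)
        nlinarith

/-- **Uniform bound for dominated convergence.** With the notation of `abs_residual_le`,
`|[B D - A√A - 2k²κ²/B - κ³] √A| ≤ 8κ²` for `|k| ≤ 1`, `0 < κ ≤ 1`. [folklore] -/
lemma abs_bracket_mul_sqrt_le (hκ : 0 < κ) (hκ1 : κ ≤ 1) (hk : k ∈ Icc (-1 : ℝ) 1) :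
    |(imRoot k κ * dRoot k κ - (1 - k ^ 2) * √(1 - k ^ 2)
        - 2 * k ^ 2 * κ ^ 2 / imRoot k κ - κ ^ 3) * √(1 - k ^ 2)| ≤ 8 * κ ^ 2 := by
  set A := 1 - k ^ 2 with hA'
  have hk2 : k ^ 2 ≤ 1 := by nlinarith [hk.1, hk.2]
  have hA : 0 ≤ A := by rw [hA']; linarith
  have hA1 : A ≤ 1 := by rw [hA']; nlinarith
  have hB := imRoot_pos k hκ
  have hD : dRoot k κ = A + κ ^ 2 := by simp [dRoot, hA']
  have hsA1 : √A ≤ 1 := by rw [show (1:ℝ) = √1 by simp]; exact Real.sqrt_le_sqrt hA1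
  have hsA0 : 0 ≤ √A := Real.sqrt_nonneg A
  set ω := imRoot k κ - √A with hω
  have hω0 : 0 ≤ ω := imRoot_sub_sqrt_nonneg hκ
  have hAB : √A ≤ imRoot k κ := by linarith
  have hbr : (imRoot k κ * dRoot k κ - A * √A - 2 * k ^ 2 * κ ^ 2 / imRoot k κ - κ ^ 3) * √A
      = (κ ^ 2 * √A * √A + ω * (A + κ ^ 2) * √A)
        - (2 * k ^ 2 * κ ^ 2 * (√A / imRoot k κ) + κ ^ 3 * √A) := by
    rw [hD, hω]; field_simp; ring
  rw [hbr]
  have t1 : κ ^ 2 * √A * √A ≤ κ ^ 2 := by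
    rw [mul_assoc, Real.mul_self_sqrt hA]; nlinarith [sq_nonneg κ]
  have t2 : ω * (A + κ ^ 2) * √A ≤ 4 * κ ^ 2 := by
    rcases le_or_gt κ A with hκA | hκA
    · have hA0 : 0 < A := lt_of_lt_of_le hκ hκA
      have hsA : 0 < √A := Real.sqrt_pos.2 hA0
      have h1 := imRoot_sub_sqrt_le_bulk hκ hA0
      calc ω * (A + κ ^ 2) * √A ≤ κ ^ 2 / (A * √A) * (A + κ ^ 2) * √A := by gcongr
        _ = κ ^ 2 * (A + κ ^ 2) / A := by field_simp
        _ ≤ 4 * κ ^ 2 := by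
            rw [div_le_iff₀ hA0]
            have hκ2A : κ ^ 2 ≤ A := by nlinarith
            nlinarith [sq_nonneg κ, mul_le_mul_of_nonneg_left hκ2A (sq_nonneg κ)]
    · have h1 := imRoot_sub_sqrt_le_edge hκ hκ1 hk
      have hs : 0 < √(A + κ) := Real.sqrt_pos.2 (by positivity)
      have hsAκ : √A ≤ √(A + κ) := Real.sqrt_le_sqrt (by linarith)
      have h2 : ω * √A ≤ 2 * κ := by
        calc ω * √A ≤ 2 * κ / √(A + κ) * √(A + κ) := by gcongr
          _ = 2 * κ := by field_simp
      calc ω * (A + κ ^ 2) * √A = (ω * √A) * (A + κ ^ 2) := by ring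
        _ ≤ (2 * κ) * (A + κ ^ 2) := by gcongr
        _ ≤ 4 * κ ^ 2 := by nlinarith
  have t3 : 2 * k ^ 2 * κ ^ 2 * (√A / imRoot k κ) ≤ 2 * κ ^ 2 := by
    have : √A / imRoot k κ ≤ 1 := by rw [div_le_one hB]; exact hAB
    have : k ^ 2 * (√A / imRoot k κ) ≤ 1 := by nlinarith [div_nonneg hsA0 hB.le]
    nlinarith [sq_nonneg κ]
  have t4 : κ ^ 3 * √A ≤ κ ^ 2 := by
    calc κ ^ 3 * √A ≤ κ ^ 3 * 1 := by gcongr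
      _ ≤ κ ^ 2 := by nlinarith [sq_nonneg κ]
  have hpos1 : 0 ≤ κ ^ 2 * √A * √A + ω * (A + κ ^ 2) * √A := by positivity
  have hpos2 : 0 ≤ 2 * k ^ 2 * κ ^ 2 * (√A / imRoot k κ) + κ ^ 3 * √A := by positivity
  rw [abs_le]; constructor <;> nlinarith

end Pointwise


/-! ### One-dimensional integral bounds -/

section OneDim

variable {κ : ℝ}

/-- On `[-1,1]`, `1 - k² + κ` dominates `1 - k + κ` or `1 + k + κ`. [folklore] -/
lemma side_le_one_sub_sq {k : ℝ} (hk : k ∈ Icc (-1 : ℝ) 1) (κ : ℝ) :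
    (1 - k + κ ≤ 1 - k ^ 2 + κ) ∨ (1 + k + κ ≤ 1 - k ^ 2 + κ) := by
  rcases le_or_gt 0 k with h | h
  · left; nlinarith [hk.2]
  · right; nlinarith [hk.1]

/-- `∫_{-1}^{1} (1-k+κ)⁻¹ dk = ∫_{-1}^{1} (1+k+κ)⁻¹ dk = log((2+κ)/κ)`. [folklore] -/
lemma integral_inv_side (hκ : 0 < κ) :
    (∫ k in (-1 : ℝ)..1, (1 - k + κ)⁻¹) = Real.log ((2 + κ) / κ)
      ∧ (∫ k in (-1 : ℝ)..1, (1 + k + κ)⁻¹) = Real.log ((2 + κ) / κ) := by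
  constructor
  · have h := intervalIntegral.integral_comp_sub_left (fun x : ℝ => x⁻¹) (1 + κ) (a := -1) (b := 1)
    have e1 : ∀ k : ℝ, 1 - k + κ = 1 + κ - k := by intro k; ring
    simp_rw [e1]
    rw [h, show (1 : ℝ) + κ - 1 = κ by ring, show (1 : ℝ) + κ - -1 = 2 + κ by ring,
      integral_inv_of_pos hκ (by linarith)]
  · have h := intervalIntegral.integral_comp_add_right (fun x : ℝ => x⁻¹) (1 + κ) (a := -1) (b := 1)
    have e1 : ∀ k : ℝ, 1 + k + κ = k + (1 + κ) := by intro k; ring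
    simp_rw [e1]
    rw [h, show (-1 : ℝ) + (1 + κ) = κ by ring, show (1 : ℝ) + (1 + κ) = 2 + κ by ring,
      integral_inv_of_pos hκ (by linarith)]

/-- `∫_{-1}^{1} dk/(1-k²+κ) ≤ 2 log((2+κ)/κ)`. [folklore] -/
lemma integral_inv_one_sub_sq_add_le (hκ : 0 < κ) :
    ∫ k in (-1 : ℝ)..1, (1 - k ^ 2 + κ)⁻¹ ≤ 2 * Real.log ((2 + κ) / κ) := by
  obtain ⟨h1, h2⟩ := integral_inv_side hκ
  have hc1 : ContinuousOn (fun k : ℝ => (1 - k + κ)⁻¹) (Icc (-1) 1) := by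
    apply ContinuousOn.inv₀ (by fun_prop); intro k hk; linarith [hk.2]
  have hc2 : ContinuousOn (fun k : ℝ => (1 + k + κ)⁻¹) (Icc (-1) 1) := by
    apply ContinuousOn.inv₀ (by fun_prop); intro k hk; linarith [hk.1]
  have hc0 : ContinuousOn (fun k : ℝ => (1 - k ^ 2 + κ)⁻¹) (Icc (-1) 1) := by
    apply ContinuousOn.inv₀ (by fun_prop); intro k hk; nlinarith [hk.1, hk.2]
  calc ∫ k in (-1 : ℝ)..1, (1 - k ^ 2 + κ)⁻¹
      ≤ ∫ k in (-1 : ℝ)..1, ((1 - k + κ)⁻¹ + (1 + k + κ)⁻¹) := by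
        apply intervalIntegral.integral_mono_on (by norm_num)
          (hc0.intervalIntegrable_of_Icc (by norm_num))
          ((hc1.add hc2).intervalIntegrable_of_Icc (by norm_num))
        intro k hk
        simp only [Pi.add_apply]
        have hu : 0 < 1 - k + κ := by linarith [hk.2]
        have hv : 0 < 1 + k + κ := by linarith [hk.1]
        rcases side_le_one_sub_sq hk κ with h | h
        · have := inv_anti₀ hu h
          have := inv_nonneg.2 hv.le
          linarith
        · have := inv_anti₀ hv h
          have := inv_nonneg.2 hu.le
          linarith
    _ = 2 * Real.log ((2 + κ) / κ) := by
        rw [intervalIntegral.integral_add (hc1.intervalIntegrable_of_Icc (by norm_num))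
          (hc2.intervalIntegrable_of_Icc (by norm_num)), h1, h2]
        ring

/-- Antiderivative of `(x√x)⁻¹`: `d/dx (-2/√x) = 1/(x√x)` for `x > 0`. [folklore] -/
lemma hasDerivAt_neg_two_div_sqrt {x : ℝ} (hx : 0 < x) :
    HasDerivAt (fun y : ℝ => -2 * (√y)⁻¹) ((x * √x)⁻¹) x := by
  have h1 := (Real.hasDerivAt_sqrt hx.ne').inv (Real.sqrt_pos.2 hx).ne'
  have h2 := h1.const_mul (-2)
  apply h2.congr_deriv
  have hs : 0 < √x := Real.sqrt_pos.2 hx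
  have hs2 : √x ^ 2 = x := Real.sq_sqrt hx.le
  rw [hs2]
  field_simp

/-- Antiderivative of `(√x)⁻¹`: `d/dx (2√x) = 1/√x` for `x > 0`. [folklore] -/
lemma hasDerivAt_two_mul_sqrt {x : ℝ} (hx : 0 < x) :
    HasDerivAt (fun y : ℝ => 2 * √y) ((√x)⁻¹) x := by
  have h2 := (Real.hasDerivAt_sqrt hx.ne').const_mul 2
  apply h2.congr_deriv
  have hs : 0 < √x := Real.sqrt_pos.2 hx
  field_simp

/-- `∫_{κ}^{2+κ} dx/(x√x) ≤ 2/√κ`. [folklore] -/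
lemma integral_inv_mul_sqrt_le (hκ : 0 < κ) :
    ∫ x in κ..(2 + κ), (x * √x)⁻¹ ≤ 2 / √κ := by
  have hcont : ContinuousOn (fun x : ℝ => (x * √x)⁻¹) (Icc κ (2 + κ)) := by
    apply ContinuousOn.inv₀ (by fun_prop)
    intro x hx; have : 0 < x := by linarith [hx.1]
    positivity
  rw [intervalIntegral.integral_eq_sub_of_hasDerivAt_of_le (by linarith)
    (f := fun y : ℝ => -2 * (√y)⁻¹)]
  · have h1 : 0 < √(2 + κ) := Real.sqrt_pos.2 (by linarith)
    have : 0 ≤ 2 * (√(2 + κ))⁻¹ := by positivity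
    have hs : 0 < √κ := Real.sqrt_pos.2 hκ
    rw [div_eq_mul_inv]
    linarith
  · apply ContinuousOn.mul continuousOn_const
    apply ContinuousOn.inv₀ (by fun_prop)
    intro x hx; exact (Real.sqrt_pos.2 (by linarith [hx.1])).ne'
  · intro x hx; exact hasDerivAt_neg_two_div_sqrt (by linarith [hx.1])
  · exact hcont.intervalIntegrable_of_Icc (by linarith)

/-- `∫_{κ}^{2+κ} dx/√x ≤ 2√3` for `κ ≤ 1`. [folklore] -/
lemma integral_inv_sqrt_le (hκ : 0 < κ) (hκ1 : κ ≤ 1) :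
    ∫ x in κ..(2 + κ), (√x)⁻¹ ≤ 2 * √3 := by
  have hcont : ContinuousOn (fun x : ℝ => (√x)⁻¹) (Icc κ (2 + κ)) := by
    apply ContinuousOn.inv₀ (by fun_prop)
    intro x hx; exact (Real.sqrt_pos.2 (by linarith [hx.1])).ne'
  rw [intervalIntegral.integral_eq_sub_of_hasDerivAt_of_le (by linarith) (f := fun y : ℝ => 2 * √y)
    (by fun_prop) (fun x hx => hasDerivAt_two_mul_sqrt (by linarith [hx.1]))
    (hcont.intervalIntegrable_of_Icc (by linarith))]
  have h1 : √(2 + κ) ≤ √3 := Real.sqrt_le_sqrt (by linarith)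
  have h2 : 0 ≤ √κ := Real.sqrt_nonneg κ
  linarith

/-- Transport of `∫_{κ}^{2+κ}` bounds to the two sides `1 ∓ k + κ`. [folklore] -/
lemma integral_comp_sides (φ : ℝ → ℝ) (κ : ℝ) :
    (∫ k in (-1 : ℝ)..1, φ (1 - k + κ)) = ∫ x in κ..(2 + κ), φ x
      ∧ (∫ k in (-1 : ℝ)..1, φ (1 + k + κ)) = ∫ x in κ..(2 + κ), φ x := by
  constructor
  · have h := intervalIntegral.integral_comp_sub_left φ (1 + κ) (a := -1) (b := 1)
    have e1 : ∀ k : ℝ, 1 - k + κ = 1 + κ - k := by intro k; ring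
    simp_rw [e1]
    rw [h, show (1 : ℝ) + κ - 1 = κ by ring, show (1 : ℝ) + κ - -1 = 2 + κ by ring]
  · have h := intervalIntegral.integral_comp_add_right φ (1 + κ) (a := -1) (b := 1)
    have e1 : ∀ k : ℝ, 1 + k + κ = k + (1 + κ) := by intro k; ring
    simp_rw [e1]
    rw [h, show (-1 : ℝ) + (1 + κ) = κ by ring, show (1 : ℝ) + (1 + κ) = 2 + κ by ring]

/-- `∫_{-1}^{1} dk/((1-k²+κ)√(1-k²+κ)) ≤ 4/√κ`. [folklore] -/
lemma integral_inv_pow_three_halves_le (hκ : 0 < κ) :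
    ∫ k in (-1 : ℝ)..1, ((1 - k ^ 2 + κ) * √(1 - k ^ 2 + κ))⁻¹ ≤ 4 / √κ := by
  set φ : ℝ → ℝ := fun x => (x * √x)⁻¹ with hφ
  obtain ⟨h1, h2⟩ := integral_comp_sides φ κ
  have hI : ∫ x in κ..(2 + κ), φ x ≤ 2 / √κ := integral_inv_mul_sqrt_le hκ
  have hφc : ContinuousOn φ (Ici κ) := by
    apply ContinuousOn.inv₀ (by fun_prop)
    intro x hx; have : 0 < x := lt_of_lt_of_le hκ hx
    positivity
  have hanti : ∀ x y : ℝ, κ ≤ x → x ≤ y → φ y ≤ φ x := by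
    intro x y hx hxy
    have hx0 : 0 < x := lt_of_lt_of_le hκ hx
    have hy0 : 0 ≤ y := by linarith
    simp only [hφ]
    apply inv_anti₀ (by positivity)
    gcongr
  have hc1 : ContinuousOn (fun k : ℝ => φ (1 - k + κ)) (Icc (-1) 1) :=
    hφc.comp (by fun_prop) fun k hk => by simp only [mem_Ici]; linarith [hk.2]
  have hc2 : ContinuousOn (fun k : ℝ => φ (1 + k + κ)) (Icc (-1) 1) :=
    hφc.comp (by fun_prop) fun k hk => by simp only [mem_Ici]; linarith [hk.1]
  have hc0 : ContinuousOn (fun k : ℝ => φ (1 - k ^ 2 + κ)) (Icc (-1) 1) :=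
    hφc.comp (by fun_prop) fun k hk => by simp only [mem_Ici]; nlinarith [hk.1, hk.2]
  calc ∫ k in (-1 : ℝ)..1, ((1 - k ^ 2 + κ) * √(1 - k ^ 2 + κ))⁻¹
      = ∫ k in (-1 : ℝ)..1, φ (1 - k ^ 2 + κ) := rfl
    _ ≤ ∫ k in (-1 : ℝ)..1, (φ (1 - k + κ) + φ (1 + k + κ)) := by
        apply intervalIntegral.integral_mono_on (by norm_num)
          (hc0.intervalIntegrable_of_Icc (by norm_num))
          ((hc1.add hc2).intervalIntegrable_of_Icc (by norm_num))
        intro k hk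
        simp only [Pi.add_apply]
        have hu : κ ≤ 1 - k + κ := by linarith [hk.2]
        have hv : κ ≤ 1 + k + κ := by linarith [hk.1]
        have hpu : 0 ≤ φ (1 - k + κ) := by
          simp only [hφ]; have : 0 < 1 - k + κ := by linarith
          positivity
        have hpv : 0 ≤ φ (1 + k + κ) := by
          simp only [hφ]; have : 0 < 1 + k + κ := by linarith
          positivity
        rcases side_le_one_sub_sq hk κ with h | h
        · have := hanti _ _ hu h; linarith
        · have := hanti _ _ hv h; linarith
    _ ≤ 4 / √κ := by
        rw [intervalIntegral.integral_add (hc1.intervalIntegrable_of_Icc (by norm_num))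
          (hc2.intervalIntegrable_of_Icc (by norm_num)), h1, h2]
        have : 4 / √κ = 2 / √κ + 2 / √κ := by ring
        linarith

/-- `∫_{-1}^{1} dk/√(1-k²+κ) ≤ 4√3` for `κ ≤ 1`. [folklore] -/
lemma integral_inv_sqrt_one_sub_sq_le (hκ : 0 < κ) (hκ1 : κ ≤ 1) :
    ∫ k in (-1 : ℝ)..1, (√(1 - k ^ 2 + κ))⁻¹ ≤ 4 * √3 := by
  set φ : ℝ → ℝ := fun x => (√x)⁻¹ with hφ
  obtain ⟨h1, h2⟩ := integral_comp_sides φ κ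
  have hI : ∫ x in κ..(2 + κ), φ x ≤ 2 * √3 := integral_inv_sqrt_le hκ hκ1
  have hφc : ContinuousOn φ (Ici κ) := by
    apply ContinuousOn.inv₀ (by fun_prop)
    intro x hx; exact (Real.sqrt_pos.2 (lt_of_lt_of_le hκ hx)).ne'
  have hanti : ∀ x y : ℝ, κ ≤ x → x ≤ y → φ y ≤ φ x := by
    intro x y hx hxy
    have hx0 : 0 < x := lt_of_lt_of_le hκ hx
    simp only [hφ]
    apply inv_anti₀ (by positivity)
    exact Real.sqrt_le_sqrt hxy
  have hc1 : ContinuousOn (fun k : ℝ => φ (1 - k + κ)) (Icc (-1) 1) :=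
    hφc.comp (by fun_prop) fun k hk => by simp only [mem_Ici]; linarith [hk.2]
  have hc2 : ContinuousOn (fun k : ℝ => φ (1 + k + κ)) (Icc (-1) 1) :=
    hφc.comp (by fun_prop) fun k hk => by simp only [mem_Ici]; linarith [hk.1]
  have hc0 : ContinuousOn (fun k : ℝ => φ (1 - k ^ 2 + κ)) (Icc (-1) 1) :=
    hφc.comp (by fun_prop) fun k hk => by simp only [mem_Ici]; nlinarith [hk.1, hk.2]
  calc ∫ k in (-1 : ℝ)..1, (√(1 - k ^ 2 + κ))⁻¹
      = ∫ k in (-1 : ℝ)..1, φ (1 - k ^ 2 + κ) := rfl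
    _ ≤ ∫ k in (-1 : ℝ)..1, (φ (1 - k + κ) + φ (1 + k + κ)) := by
        apply intervalIntegral.integral_mono_on (by norm_num)
          (hc0.intervalIntegrable_of_Icc (by norm_num))
          ((hc1.add hc2).intervalIntegrable_of_Icc (by norm_num))
        intro k hk
        simp only [Pi.add_apply]
        have hu : κ ≤ 1 - k + κ := by linarith [hk.2]
        have hv : κ ≤ 1 + k + κ := by linarith [hk.1]
        have hpu : 0 ≤ φ (1 - k + κ) := by simp only [hφ]; positivity
        have hpv : 0 ≤ φ (1 + k + κ) := by simp only [hφ]; positivity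
        rcases side_le_one_sub_sq hk κ with h | h
        · have := hanti _ _ hu h; linarith
        · have := hanti _ _ hv h; linarith
    _ ≤ 4 * √3 := by
        rw [intervalIntegral.integral_add (hc1.intervalIntegrable_of_Icc (by norm_num))
          (hc2.intervalIntegrable_of_Icc (by norm_num)), h1, h2]
        linarith

/-- `∫_{-1}^{1} (1-k²)√(1-k²) dk = 3π/8`. [folklore] -/
lemma integral_sqrt_three : ∫ k in (-1 : ℝ)..1, (1 - k ^ 2) * √(1 - k ^ 2) = 3 * π / 8 := by
  rw [integral_comp_cos_mul_sin (by fun_prop)]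
  have hpt : EqOn (fun θ => (1 - Real.cos θ ^ 2) * √(1 - Real.cos θ ^ 2) * Real.sin θ)
      (fun θ => Real.sin θ ^ (2 * 2)) (uIcc 0 π) := by
    intro θ hθ
    rw [uIcc_of_le Real.pi_pos.le] at hθ
    have hs : 0 ≤ Real.sin θ := Real.sin_nonneg_of_nonneg_of_le_pi hθ.1 hθ.2
    simp only
    rw [← Real.sin_sq, Real.sqrt_sq hs]
    ring
  rw [intervalIntegral.integral_congr hpt, integral_sin_pow_even]
  simp [Finset.prod_range_succ]
  ring

/-- `∫_{-1}^{1} (1 - 2k²) dk = 2/3`. [folklore] -/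
lemma integral_one_sub_two_mul_sq : ∫ k in (-1 : ℝ)..1, (1 - 2 * k ^ 2) = 2 / 3 := by
  rw [intervalIntegral.integral_sub intervalIntegrable_const
    (Continuous.intervalIntegrable (by fun_prop) _ _),
    intervalIntegral.integral_const_mul, integral_pow]
  simp
  norm_num

end OneDim



/-! ### The two duality identities -/

section Identities

variable {κ : ℝ} {g : ℝ → ℝ}

/-- Continuity of `k ↦ B(k, κ)`. [folklore] -/
lemma continuous_imRoot (κ : ℝ) : Continuous (fun k => imRoot k κ) := by
  unfold imRoot dRoot; fun_prop

/-- **Mass identity.** `κ ∫g = 1/4 + ∫ (B - √(1-k²)) g`, i.e. `m = 4κ∫g = 1 + 4∫ωg`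
(duality with the test function `√(1-k²)`). [folklore] -/
theorem kappa_mul_integral_eq (hκ : 0 < κ) (hg : ContinuousOn g (Icc (-1) 1))
    (hgeq : ∀ k ∈ Icc (-1 : ℝ) 1,
      g k = 1 / (2 * π) + π⁻¹ * ∫ p in (-1 : ℝ)..1, g p * poissonKernel κ k p) :
    κ * ∫ k in (-1 : ℝ)..1, g k
      = 1 / 4 + ∫ k in (-1 : ℝ)..1, (imRoot k κ - √(1 - k ^ 2)) * g k := by
  have hπ := Real.pi_pos
  have hd := duality hκ hg hgeq (v := fun k => √(1 - k ^ 2)) (by fun_prop)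
  simp_rw [integral_sqrt_mul_poissonKernel _ hκ] at hd
  rw [integral_sqrt_one_sub_sq] at hd
  have e : ∀ k : ℝ, π * (imRoot k κ - κ) * g k
      = π * ((imRoot k κ - √(1 - k ^ 2)) * g k + √(1 - k ^ 2) * g k - κ * g k) := by
    intro k; ring
  simp_rw [e] at hd
  have hi1' : IntervalIntegrable (fun k => (imRoot k κ - √(1 - k ^ 2)) * g k) volume (-1) 1 := by
    apply ContinuousOn.intervalIntegrable_of_Icc (by norm_num)
    exact ((continuous_imRoot κ).sub (by fun_prop)).continuousOn.mul hg
  have hi2 : IntervalIntegrable (fun k => √(1 - k ^ 2) * g k) volume (-1) 1 := by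
    apply ContinuousOn.intervalIntegrable_of_Icc (by norm_num)
    exact (Continuous.continuousOn (by fun_prop)).mul hg
  have hi3 : IntervalIntegrable (fun k => κ * g k) volume (-1) 1 :=
    (hg.intervalIntegrable_of_Icc (by norm_num)).const_mul κ
  rw [intervalIntegral.integral_const_mul, intervalIntegral.integral_sub (hi1'.add hi2) hi3,
    intervalIntegral.integral_add hi1' hi2, intervalIntegral.integral_const_mul] at hd
  field_simp at hd
  linarith

/-- Continuity of the residual `r₀(k) = (2/(3κ))[B D - (1-k²)√(1-k²) - 2k²κ²/B - κ³]` in `k`.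
[folklore] -/
lemma continuous_residual (hκ : 0 < κ) :
    Continuous (fun k : ℝ => 2 / (3 * κ) * (imRoot k κ * dRoot k κ - (1 - k ^ 2) * √(1 - k ^ 2)
      - 2 * k ^ 2 * κ ^ 2 / imRoot k κ - κ ^ 3)) := by
  have hB := continuous_imRoot κ
  have hB0 : ∀ k, imRoot k κ ≠ 0 := fun k => (imRoot_pos k hκ).ne'
  apply Continuous.mul continuous_const
  apply Continuous.sub _ continuous_const
  apply Continuous.sub
  · unfold dRoot; fun_prop
  · exact Continuous.div (by fun_prop) hB hB0

/-- **Second-moment identity.** `∫ (2k²-1) g = -1/(8κ) - ∫ r₀ g` with the residual `r₀` of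
`continuous_residual` (duality with the test function `-(2/(3κ))(1-k²)√(1-k²)`, whose image under
`I - K_κ` is `(2k² - 1) + r₀`). [folklore] -/
theorem integral_chebyshev_mul_eq (hκ : 0 < κ) (hg : ContinuousOn g (Icc (-1) 1))
    (hgeq : ∀ k ∈ Icc (-1 : ℝ) 1,
      g k = 1 / (2 * π) + π⁻¹ * ∫ p in (-1 : ℝ)..1, g p * poissonKernel κ k p) :
    ∫ k in (-1 : ℝ)..1, (2 * k ^ 2 - 1) * g k
      = -1 / (8 * κ) - ∫ k in (-1 : ℝ)..1, 2 / (3 * κ) * (imRoot k κ * dRoot k κ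
          - (1 - k ^ 2) * √(1 - k ^ 2) - 2 * k ^ 2 * κ ^ 2 / imRoot k κ - κ ^ 3) * g k := by
  have hπ := Real.pi_pos
  have hd := duality hκ hg hgeq (v := fun k => (1 - k ^ 2) * √(1 - k ^ 2)) (by fun_prop)
  simp_rw [integral_sqrt_three_mul_poissonKernel _ hκ] at hd
  rw [integral_sqrt_three] at hd
  -- pointwise: `v - N = -(3κ/2)(r₀ + T₂)`
  set r : ℝ → ℝ := fun k => 2 / (3 * κ) * (imRoot k κ * dRoot k κ
    - (1 - k ^ 2) * √(1 - k ^ 2) - 2 * k ^ 2 * κ ^ 2 / imRoot k κ - κ ^ 3) with hr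
  have e : ∀ k : ℝ, π * (dRoot k κ * imRoot k κ - dRoot k κ * κ - 2 * k ^ 2 * κ ^ 2 / imRoot k κ
        + 2 * k ^ 2 * κ - κ / 2) * g k
      = π * ((1 - k ^ 2) * √(1 - k ^ 2) * g k
          + 3 * κ / 2 * (r k * g k + (2 * k ^ 2 - 1) * g k)) := by
    intro k
    simp only [hr, dRoot]
    field_simp
    ring
  simp_rw [e] at hd
  have hvg : IntervalIntegrable (fun k => (1 - k ^ 2) * √(1 - k ^ 2) * g k) volume (-1) 1 := by
    apply ContinuousOn.intervalIntegrable_of_Icc (by norm_num)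
    exact (Continuous.continuousOn (by fun_prop)).mul hg
  have hrg : IntervalIntegrable (fun k => r k * g k) volume (-1) 1 := by
    apply ContinuousOn.intervalIntegrable_of_Icc (by norm_num)
    exact (continuous_residual hκ).continuousOn.mul hg
  have hTg : IntervalIntegrable (fun k => (2 * k ^ 2 - 1) * g k) volume (-1) 1 := by
    apply ContinuousOn.intervalIntegrable_of_Icc (by norm_num)
    exact (Continuous.continuousOn (by fun_prop)).mul hg
  rw [intervalIntegral.integral_const_mul, intervalIntegral.integral_add hvg
    ((hrg.add hTg).const_mul _), intervalIntegral.integral_const_mul,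
    intervalIntegral.integral_add hrg hTg] at hd
  have e1 : π⁻¹ * (π * ((∫ k in (-1 : ℝ)..1, (1 - k ^ 2) * √(1 - k ^ 2) * g k)
      + 3 * κ / 2 * ((∫ k in (-1 : ℝ)..1, r k * g k) + ∫ k in (-1 : ℝ)..1, (2 * k ^ 2 - 1) * g k)))
      = (∫ k in (-1 : ℝ)..1, (1 - k ^ 2) * √(1 - k ^ 2) * g k)
        + 3 * κ / 2 * ((∫ k in (-1 : ℝ)..1, r k * g k)
          + ∫ k in (-1 : ℝ)..1, (2 * k ^ 2 - 1) * g k) := by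
    field_simp
  have e2 : 1 / (2 * π) * (3 * π / 8) = 3 / 16 := by field_simp; ring
  rw [e1, e2] at hd
  have hX : 3 * κ / 2 * ((∫ k in (-1 : ℝ)..1, r k * g k)
      + ∫ k in (-1 : ℝ)..1, (2 * k ^ 2 - 1) * g k) = -(3 / 16) := by linarith
  have hY : (∫ k in (-1 : ℝ)..1, r k * g k) + (∫ k in (-1 : ℝ)..1, (2 * k ^ 2 - 1) * g k)
      = -1 / (8 * κ) := by
    have : (∫ k in (-1 : ℝ)..1, r k * g k) + (∫ k in (-1 : ℝ)..1, (2 * k ^ 2 - 1) * g k)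
        = 2 / (3 * κ) * (3 * κ / 2 * ((∫ k in (-1 : ℝ)..1, r k * g k)
          + ∫ k in (-1 : ℝ)..1, (2 * k ^ 2 - 1) * g k)) := by
      field_simp
    rw [this, hX]
    field_simp
    norm_num
  show (∫ k in (-1 : ℝ)..1, (2 * k ^ 2 - 1) * g k) = -1 / (8 * κ) - ∫ k in (-1 : ℝ)..1, r k * g k
  linarith

end Identities

/-! ### The two small terms: `m - 1` and `∫ r₀ (g - g₀)` -/

section Estimates

variable {κ η : ℝ} {g : ℝ → ℝ}

/-- `√(x + y) ≤ √x + √y`. [folklore] -/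
lemma sqrt_add_le_sqrt_add_sqrt {x y : ℝ} (hx : 0 ≤ x) (hy : 0 ≤ y) : √(x + y) ≤ √x + √y := by
  rw [Real.sqrt_le_left (by positivity)]
  have := Real.sq_sqrt hx; have := Real.sq_sqrt hy
  nlinarith [Real.sqrt_nonneg x, Real.sqrt_nonneg y]

/-- The supersolution with `a² = 1 + η`: `g ≤ √(1-k²+η)/(πκ)` when `θ = κ(1+η)/(2η√η) ≤ 1/2`.
[folklore] -/
lemma solution_le_sqrt_div_eta (hκ : 0 < κ) (hη : 0 < η)
    (hθ : κ * (1 + η) / (2 * η * √η) ≤ 1 / 2) (hg : ContinuousOn g (Icc (-1) 1))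
    (hgeq : ∀ k ∈ Icc (-1 : ℝ) 1,
      g k = 1 / (2 * π) + π⁻¹ * ∫ p in (-1 : ℝ)..1, g p * poissonKernel κ k p) :
    ∀ k ∈ Icc (-1 : ℝ) 1, g k ≤ √(1 - k ^ 2 + η)
      / (2 * π * κ * (1 - κ * (1 + η) / (2 * η * √η))) := by
  have ha : 1 < √(1 + η) := (Real.lt_sqrt zero_le_one).2 (by nlinarith)
  have ha2 : √(1 + η) ^ 2 = 1 + η := Real.sq_sqrt (by linarith)
  have h := solution_le_sqrt_div hκ hg hgeq ha (θ := κ * (1 + η) / (2 * η * √η))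
    (by rw [ha2, add_sub_cancel_left]) (by linarith)
  intro k hk
  have := h k hk
  rw [ha2] at this
  convert this using 2
  ring_nf

/-- **First small term.** For `0 < κ ≤ η ≤ 1` with `θ = κ(1+η)/(2η√η) ≤ 1/2`:
`∫ (B - √(1-k²)) g ≤ (8/π)[κ log((2+κ)/κ) + 2√η√κ]` (so `m - 1 = O(κ log(1/κ) + √(ηκ))`).
[folklore] -/
theorem integral_omega_mul_le (hκ : 0 < κ) (hκη : κ ≤ η) (hη1 : η ≤ 1)
    (hθ : κ * (1 + η) / (2 * η * √η) ≤ 1 / 2) (hg : ContinuousOn g (Icc (-1) 1))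
    (hgeq : ∀ k ∈ Icc (-1 : ℝ) 1,
      g k = 1 / (2 * π) + π⁻¹ * ∫ p in (-1 : ℝ)..1, g p * poissonKernel κ k p) :
    ∫ k in (-1 : ℝ)..1, (imRoot k κ - √(1 - k ^ 2)) * g k
      ≤ 8 / π * (κ * Real.log ((2 + κ) / κ) + 2 * √η * √κ) := by
  have hπ := Real.pi_pos
  have hκ1 : κ ≤ 1 := le_trans hκη hη1
  have hη : 0 < η := lt_of_lt_of_le hκ hκη
  set θ := κ * (1 + η) / (2 * η * √η) with hθdef
  have hθ0 : 0 < θ := by positivity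
  have hsup := solution_le_sqrt_div_eta hκ hη hθ hg hgeq
  -- pointwise majorant
  set h : ℝ → ℝ := fun k => 4 * κ / π * ((1 - k ^ 2 + κ)⁻¹
    + √η * ((1 - k ^ 2 + κ) * √(1 - k ^ 2 + κ))⁻¹) with hh
  have hpt : ∀ k ∈ Icc (-1 : ℝ) 1, (imRoot k κ - √(1 - k ^ 2)) * g k ≤ h k := by
    intro k hk
    set A := 1 - k ^ 2 with hA'
    have hA : 0 ≤ A := by rw [hA']; nlinarith [hk.1, hk.2]
    have hs : 0 < √(A + κ) := Real.sqrt_pos.2 (by positivity)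
    have hω0 : 0 ≤ imRoot k κ - √A := imRoot_sub_sqrt_nonneg hκ
    have hω := imRoot_sub_sqrt_le hκ hκ1 hk
    have hgk := hsup k hk
    have h1θ : 1 / 2 ≤ 1 - θ := by linarith
    have hden : 0 < 2 * π * κ * (1 - θ) := by
      have : (0:ℝ) < 1 - θ := by linarith
      positivity
    have hu : √(1 - k ^ 2 + η) / (2 * π * κ * (1 - θ)) ≤ (√(A + κ) + √η) / (π * κ) := by
      rw [div_le_div_iff₀ hden (by positivity)]
      have h1 : √(1 - k ^ 2 + η) ≤ √(A + κ) + √η := by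
        calc √(1 - k ^ 2 + η) = √(A + η) := by rw [hA']
          _ ≤ √A + √η := sqrt_add_le_sqrt_add_sqrt hA hη.le
          _ ≤ √(A + κ) + √η := by gcongr; linarith
      have h2 : π * κ ≤ 2 * π * κ * (1 - θ) := by
        have := mul_le_mul_of_nonneg_left h1θ (by positivity : 0 ≤ 2 * π * κ)
        linarith
      calc √(1 - k ^ 2 + η) * (π * κ) ≤ (√(A + κ) + √η) * (π * κ) := by gcongr
        _ ≤ (√(A + κ) + √η) * (2 * π * κ * (1 - θ)) := by gcongr
    have key : ∀ s : ℝ, s ≠ 0 → (4 * κ ^ 2 / ((1 - k ^ 2 + κ) * s)) * ((s + √η) / (π * κ))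
        = 4 * κ / π * ((1 - k ^ 2 + κ)⁻¹ + √η * ((1 - k ^ 2 + κ) * s)⁻¹) := by
      intro s hs0
      have : (1 - k ^ 2 + κ) ≠ 0 := by nlinarith [hk.1, hk.2]
      field_simp
    calc (imRoot k κ - √A) * g k
        ≤ (4 * κ ^ 2 / ((A + κ) * √(A + κ))) * ((√(A + κ) + √η) / (π * κ)) := by
          apply mul_le_mul hω (le_trans hgk hu) (solution_nonneg hκ hg hgeq k hk)
          positivity
      _ = h k := by
          simp only [hh, hA']
          exact key _ hs.ne'
  have hcont_h : ContinuousOn h (Icc (-1) 1) := by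
    simp only [hh]
    apply ContinuousOn.mul continuousOn_const
    apply ContinuousOn.add
    · apply ContinuousOn.inv₀ (by fun_prop); intro k hk; nlinarith [hk.1, hk.2]
    · apply ContinuousOn.mul continuousOn_const
      apply ContinuousOn.inv₀ (by fun_prop); intro k hk
      have : 0 < 1 - k ^ 2 + κ := by nlinarith [hk.1, hk.2]
      positivity
  have hint_lhs : IntervalIntegrable (fun k => (imRoot k κ - √(1 - k ^ 2)) * g k) volume (-1) 1 := by
    apply ContinuousOn.intervalIntegrable_of_Icc (by norm_num)
    exact ((continuous_imRoot κ).sub (by fun_prop)).continuousOn.mul hg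
  have hI1 := integral_inv_one_sub_sq_add_le hκ
  have hI2 := integral_inv_pow_three_halves_le hκ
  have hi1 : IntervalIntegrable (fun k : ℝ => (1 - k ^ 2 + κ)⁻¹) volume (-1) 1 := by
    apply ContinuousOn.intervalIntegrable_of_Icc (by norm_num)
    apply ContinuousOn.inv₀ (by fun_prop); intro k hk; nlinarith [hk.1, hk.2]
  have hi2 : IntervalIntegrable (fun k : ℝ => ((1 - k ^ 2 + κ) * √(1 - k ^ 2 + κ))⁻¹)
      volume (-1) 1 := by
    apply ContinuousOn.intervalIntegrable_of_Icc (by norm_num)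
    apply ContinuousOn.inv₀ (by fun_prop); intro k hk
    have : 0 < 1 - k ^ 2 + κ := by nlinarith [hk.1, hk.2]
    positivity
  calc ∫ k in (-1 : ℝ)..1, (imRoot k κ - √(1 - k ^ 2)) * g k
      ≤ ∫ k in (-1 : ℝ)..1, h k :=
        intervalIntegral.integral_mono_on (by norm_num) hint_lhs
          (hcont_h.intervalIntegrable_of_Icc (by norm_num)) hpt
    _ = 4 * κ / π * ((∫ k in (-1 : ℝ)..1, (1 - k ^ 2 + κ)⁻¹)
          + √η * ∫ k in (-1 : ℝ)..1, ((1 - k ^ 2 + κ) * √(1 - k ^ 2 + κ))⁻¹) := by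
        simp only [hh]
        rw [intervalIntegral.integral_const_mul, intervalIntegral.integral_add hi1
          (hi2.const_mul _), intervalIntegral.integral_const_mul]
    _ ≤ 4 * κ / π * (2 * Real.log ((2 + κ) / κ) + √η * (4 / √κ)) := by
        gcongr
    _ = 8 / π * (κ * Real.log ((2 + κ) / κ) + 2 * √η * √κ) := by
        have hsκ : 0 < √κ := Real.sqrt_pos.2 hκ
        have e4 : 4 / √κ = 4 * √κ / κ := by
          rw [div_eq_div_iff hsκ.ne' hκ.ne']
          linear_combination (-4) * Real.mul_self_sqrt hκ.le
        rw [e4]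
        field_simp
        ring

/-- **Second small term.** For `0 < κ ≤ η ≤ 1` with `θ = κ(1+η)/(2η√η) ≤ 1/2`:
`|∫ r₀ (g - √(1-k²)/(2πκ))| ≤ (8/π) η log((2+κ)/κ) + (96/π) θ`. [folklore] -/
theorem abs_integral_residual_mul_sub_le (hκ : 0 < κ) (hκη : κ ≤ η) (hη1 : η ≤ 1)
    (hθ : κ * (1 + η) / (2 * η * √η) ≤ 1 / 2) (hg : ContinuousOn g (Icc (-1) 1))
    (hgeq : ∀ k ∈ Icc (-1 : ℝ) 1,
      g k = 1 / (2 * π) + π⁻¹ * ∫ p in (-1 : ℝ)..1, g p * poissonKernel κ k p) :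
    |∫ k in (-1 : ℝ)..1, 2 / (3 * κ) * (imRoot k κ * dRoot k κ - (1 - k ^ 2) * √(1 - k ^ 2)
        - 2 * k ^ 2 * κ ^ 2 / imRoot k κ - κ ^ 3) * (g k - √(1 - k ^ 2) / (2 * π * κ))|
      ≤ 8 / π * (η * Real.log ((2 + κ) / κ)) + 96 / π * (κ * (1 + η) / (2 * η * √η)) := by
  have hπ := Real.pi_pos
  have hπ3 := Real.pi_gt_three
  have hκ1 : κ ≤ 1 := le_trans hκη hη1
  have hη : 0 < η := lt_of_lt_of_le hκ hκη
  set θ := κ * (1 + η) / (2 * η * √η) with hθdef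
  have hθ0 : 0 < θ := by positivity
  have hsup := solution_le_sqrt_div_eta hκ hη hθ hg hgeq
  have hsub := sqrt_div_le_solution hκ hg hgeq
  set r : ℝ → ℝ := fun k => 2 / (3 * κ) * (imRoot k κ * dRoot k κ
    - (1 - k ^ 2) * √(1 - k ^ 2) - 2 * k ^ 2 * κ ^ 2 / imRoot k κ - κ ^ 3) with hr
  set h : ℝ → ℝ := fun k => 4 / π * (η * (1 - k ^ 2 + κ)⁻¹
    + 2 * √2 * θ * (√(1 - k ^ 2 + κ))⁻¹) with hh
  -- pointwise: `|r (g - g₀)| ≤ h`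
  have hpt : ∀ k ∈ Icc (-1 : ℝ) 1, |r k * (g k - √(1 - k ^ 2) / (2 * π * κ))| ≤ h k := by
    intro k hk
    set A := 1 - k ^ 2 with hA'
    have hA : 0 ≤ A := by rw [hA']; nlinarith [hk.1, hk.2]
    have hA1 : A ≤ 1 := by rw [hA']; nlinarith
    have hs : 0 < √(A + κ) := Real.sqrt_pos.2 (by positivity)
    have hrk : |r k| ≤ 8 * κ / √(A + κ) := abs_residual_le hκ hκ1 hk
    have hg0 : 0 ≤ g k - √A / (2 * π * κ) := by linarith [hsub k hk]
    have hgu : g k - √A / (2 * π * κ) ≤ (η / √(A + κ) + 2 * √2 * θ) / (2 * π * κ) := by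
      have h1 := hsup k hk
      have h1θ : 1 / 2 ≤ 1 - θ := by linarith
      have hsAη : 0 < √(A + η) := Real.sqrt_pos.2 (by positivity)
      have e1 : √(1 - k ^ 2 + η) = √(A + η) := by rw [hA']
      rw [e1] at h1
      -- `√(A+η)/(1-θ) ≤ √(A+η) + 2θ√2` and `√(A+η) - √A ≤ η/√(A+κ)`
      have h2 : √(A + η) ≤ √2 := Real.sqrt_le_sqrt (by linarith)
      have h3 : √(A + η) / (2 * π * κ * (1 - θ))
          ≤ (√(A + η) + 2 * √2 * θ) / (2 * π * κ) := by
        rw [div_le_div_iff₀ (by positivity) (by positivity)]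
        have : √(A + η) * (2 * π * κ) = (√(A + η) * (1 - θ) + θ * √(A + η)) * (2 * π * κ) := by
          ring
        rw [this]
        have h4 : θ * √(A + η) ≤ 2 * √2 * θ * (1 - θ) := by
          calc θ * √(A + η) ≤ θ * √2 := by gcongr
            _ = 2 * √2 * θ * (1 / 2) := by ring
            _ ≤ 2 * √2 * θ * (1 - θ) := by gcongr
        nlinarith [mul_pos hπ hκ]
      have h5 : √(A + η) - √A ≤ η / √(A + κ) := by
        have h6 : (√(A + η) - √A) * (√(A + η) + √A) = η := by
          have := Real.sq_sqrt (by positivity : 0 ≤ A + η)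
          have := Real.sq_sqrt hA
          nlinarith
        have h7 : √(A + κ) ≤ √(A + η) + √A := by
          have := Real.sqrt_le_sqrt (by linarith : A + κ ≤ A + η)
          linarith [Real.sqrt_nonneg A]
        rw [le_div_iff₀ hs]
        have h8 : 0 ≤ √(A + η) - √A := by
          have := Real.sqrt_le_sqrt (by linarith : A ≤ A + η); linarith
        nlinarith
      calc g k - √A / (2 * π * κ)
          ≤ (√(A + η) + 2 * √2 * θ) / (2 * π * κ) - √A / (2 * π * κ) := by linarith
        _ = ((√(A + η) - √A) + 2 * √2 * θ) / (2 * π * κ) := by ring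
        _ ≤ (η / √(A + κ) + 2 * √2 * θ) / (2 * π * κ) := by gcongr
    rw [abs_mul, abs_of_nonneg hg0]
    calc |r k| * (g k - √A / (2 * π * κ))
        ≤ (8 * κ / √(A + κ)) * ((η / √(A + κ) + 2 * √2 * θ) / (2 * π * κ)) := by
          apply mul_le_mul hrk hgu hg0 (by positivity)
      _ = h k := by
          simp only [hh, hA']
          have hs2 : √(1 - k ^ 2 + κ) * √(1 - k ^ 2 + κ) = 1 - k ^ 2 + κ :=
            Real.mul_self_sqrt (by positivity)
          have key : ∀ s : ℝ, s ≠ 0 → s * s = 1 - k ^ 2 + κ →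
              (8 * κ / s) * ((η / s + 2 * √2 * θ) / (2 * π * κ))
                = 4 / π * (η * (1 - k ^ 2 + κ)⁻¹ + 2 * √2 * θ * s⁻¹) := by
            intro s hs0 hss
            rw [← hss]
            field_simp
            ring
          exact key _ hs.ne' hs2
  have hcont_h : ContinuousOn h (Icc (-1) 1) := by
    simp only [hh]
    apply ContinuousOn.mul continuousOn_const
    apply ContinuousOn.add
    · apply ContinuousOn.mul continuousOn_const
      apply ContinuousOn.inv₀ (by fun_prop); intro k hk; nlinarith [hk.1, hk.2]
    · apply ContinuousOn.mul continuousOn_const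
      apply ContinuousOn.inv₀ (by fun_prop); intro k hk
      exact (Real.sqrt_pos.2 (by nlinarith [hk.1, hk.2])).ne'
  have hint_lhs : IntervalIntegrable (fun k => r k * (g k - √(1 - k ^ 2) / (2 * π * κ)))
      volume (-1) 1 := by
    apply ContinuousOn.intervalIntegrable_of_Icc (by norm_num)
    exact (continuous_residual hκ).continuousOn.mul (hg.sub (Continuous.continuousOn (by fun_prop)))
  have hI1 := integral_inv_one_sub_sq_add_le hκ
  have hI3 := integral_inv_sqrt_one_sub_sq_le hκ hκ1
  have hi1 : IntervalIntegrable (fun k : ℝ => (1 - k ^ 2 + κ)⁻¹) volume (-1) 1 := by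
    apply ContinuousOn.intervalIntegrable_of_Icc (by norm_num)
    apply ContinuousOn.inv₀ (by fun_prop); intro k hk; nlinarith [hk.1, hk.2]
  have hi3 : IntervalIntegrable (fun k : ℝ => (√(1 - k ^ 2 + κ))⁻¹) volume (-1) 1 := by
    apply ContinuousOn.intervalIntegrable_of_Icc (by norm_num)
    apply ContinuousOn.inv₀ (by fun_prop); intro k hk
    exact (Real.sqrt_pos.2 (by nlinarith [hk.1, hk.2])).ne'
  have hbound : ∫ k in (-1 : ℝ)..1, h k
      ≤ 8 / π * (η * Real.log ((2 + κ) / κ)) + 96 / π * θ := by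
    calc ∫ k in (-1 : ℝ)..1, h k
        = 4 / π * (η * (∫ k in (-1 : ℝ)..1, (1 - k ^ 2 + κ)⁻¹)
            + 2 * √2 * θ * ∫ k in (-1 : ℝ)..1, (√(1 - k ^ 2 + κ))⁻¹) := by
          simp only [hh]
          rw [intervalIntegral.integral_const_mul, intervalIntegral.integral_add (hi1.const_mul _)
            (hi3.const_mul _), intervalIntegral.integral_const_mul,
            intervalIntegral.integral_const_mul]
      _ ≤ 4 / π * (η * (2 * Real.log ((2 + κ) / κ)) + 2 * √2 * θ * (4 * √3)) := by
          gcongr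
      _ = 8 / π * (η * Real.log ((2 + κ) / κ)) + 32 / π * (√2 * √3) * θ := by ring
      _ ≤ 8 / π * (η * Real.log ((2 + κ) / κ)) + 32 / π * 3 * θ := by
          have h2 : √2 ≤ 3 / 2 := by
            rw [Real.sqrt_le_left (by norm_num)]; norm_num
          have h3 : √3 ≤ 2 := by
            rw [Real.sqrt_le_left (by norm_num)]; norm_num
          have h23 : √2 * √3 ≤ 3 := by
            calc √2 * √3 ≤ (3 / 2) * 2 := by gcongr
              _ = 3 := by norm_num
          gcongr
      _ = 8 / π * (η * Real.log ((2 + κ) / κ)) + 96 / π * θ := by ring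
  rw [abs_le]
  constructor
  · have hm : ∫ k in (-1 : ℝ)..1, -h k
        ≤ ∫ k in (-1 : ℝ)..1, r k * (g k - √(1 - k ^ 2) / (2 * π * κ)) :=
      intervalIntegral.integral_mono_on (by norm_num)
        ((hcont_h.intervalIntegrable_of_Icc (by norm_num)).neg) hint_lhs
        (fun k hk => (abs_le.1 (hpt k hk)).1)
    rw [intervalIntegral.integral_neg] at hm
    linarith
  · have hm : ∫ k in (-1 : ℝ)..1, r k * (g k - √(1 - k ^ 2) / (2 * π * κ))
        ≤ ∫ k in (-1 : ℝ)..1, h k :=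
      intervalIntegral.integral_mono_on (by norm_num) hint_lhs
        (hcont_h.intervalIntegrable_of_Icc (by norm_num))
        (fun k hk => (abs_le.1 (hpt k hk)).2)
    linarith

end Estimates

end Literature.Barriers.AtomisticToContinuum.BoseGas.LiebLiniger

end
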